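import Summits.Ventures.CertifiedArithmetic.LowPrec.EnvelopeStructural
import Summits.Ventures.CertifiedArithmetic.LowPrec.SRBlockScaleRules

/-!
# Per-element envelope atoms, ALL REGIMES: normal ⊕ subnormal-after-scaling (MX ceil and floor rules)

HONEST FRAMING (venture CertifiedArithmetic / cell `pub-lowprec`): certified error envelopes and
provably optimal rounding/accumulation schemes for low-precision formats under stated cost models;
every table by two implementations; no hardware or vendor claims.

`EnvelopeAtoms.lean` proves the NORMAL-range atoms (L5a–c). The per-binade tables of the cell's
`envelope/THEOREM-SHAPES.md` §4.0b (certificate C56 `certs/enum/ENVELOPE-ATOMS.json`, columns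
`j ≥ 14` for E4M3, `j ≥ 2` for E2M1) also have a DEEP regime: an element that is subnormal after
scaling is rounded on the uniform grid `quantum · X`, so its error is at most `X · quantum / 2`,
which relative to the block maximum is a format constant:

* MX CEIL rule (`X = ceilScale`, never clips, `X · maxRat < 2 · amax` by minimality of the ceil
  exponent): `mxCeilAtom_all` — EVERY element of a nonzero block satisfies
  `|Vᵢ - X·fl(Vᵢ/X)| ≤ max (u/(1+u)·|Vᵢ|) (quantum/maxRat · amax)`
  (E4M3 `1/229376`, E5M2 `1/3758096384`, E2M1 `1/12`: `ceilDeepUnit_values`);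
* OCP FLOOR rule (`X = scaleRat`, `2^emaxElem · X ≤ amax`): `mxFloorAtom_unclipped` — every
  UNCLIPPED element satisfies `|Vᵢ - X·fl(Vᵢ/X)| ≤ max (u/(1+u)·|Vᵢ|) (quantum/2^(emaxElem+1) · amax)`
  (E4M3 `1/262144`, E5M2 `1/4294967296`, E2M1 `1/16`: `floorDeepUnit_values`); the clipped
  elements are `EnvelopeAtomsFloor.mxFloorClampAtom`.

Both are UPPER envelopes: in the flush-to-zero tail (`|Vᵢ| < X·quantum/2`) the true error is
`|Vᵢ|` itself, below the deep constant. References: [RouhaniEtAl2023MX] §3 (scale rules, block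
maximum); [Higham2002ASNA] Thm 2.2; [JeannerodRump2018] eq. (1.2); [MicikeviciusEtAl2022] Table 1.

Placement: venture development under `Summits/Ventures/CertifiedArithmetic/`; block-level atoms in
`Summit.Ventures.CertifiedArithmetic.LowPrec.EnvelopeAtoms`, one helper on the ceil scale as a
theorem of `Summit.Ventures.CertifiedArithmetic.LowPrec.SR` (where `ceilScale` lives).
-/

namespace Summit.Ventures.CertifiedArithmetic.LowPrec.SR

open Literature.ComputerArithmetic.FloatingPoint
open Literature.ComputerArithmetic.FloatingPoint.MXBlock

variable {φ : Format} {k : ℕ}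

/-- MINIMALITY OF THE CEIL SCALE, quantitatively: half the ceil scale would clip, i.e.
`ceilScale · maxRat < 2 · blockMax` for a nonzero block. [cite: RouhaniEtAl2023MX, §3] -/
theorem ceilScale_mul_maxRat_lt_two_mul (hM : 0 < φ.maxRat) {V : Fin k → ℚ} (hB : 0 < blockMax V) :
    ceilScale φ V * φ.maxRat < 2 * blockMax V := by
  have hr : 0 < blockMax V / φ.maxRat := div_pos hB hM
  have h := Int.zpow_pred_clog_lt_self (R := ℚ) (b := 2) (by norm_num) hr
  push_cast at h
  rw [zpow_sub_one₀ (by norm_num : (2 : ℚ) ≠ 0), lt_div_iff₀ hM] at h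
  unfold ceilScale ceilExp
  linarith

end Summit.Ventures.CertifiedArithmetic.LowPrec.SR

namespace Summit.Ventures.CertifiedArithmetic.LowPrec.EnvelopeAtoms

open Literature.ComputerArithmetic.FloatingPoint
open Literature.ComputerArithmetic.FloatingPoint.Format
open Literature.ComputerArithmetic.FloatingPoint.MiniFloat
open Literature.ComputerArithmetic.FloatingPoint.MXBlock
open Summit.Ventures.CertifiedArithmetic.LowPrec.SR

/-- SCALED ELEMENT, BOTH REGIMES: for a scale `X > 0` and an element with `|v|/X ≤ maxRat`,
`|v - X·fl(v/X)| ≤ max (u/(1+u)·|v|) (X · quantum/2)` — the sharp standard model if the scaled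
element is normal, half a quantum (times the scale) otherwise. [cite: Higham2002ASNA, Thm 2.2] -/
theorem scaled_elem_error_le (φ : Format) {X v : ℚ} (hX : 0 < X) (h : |v| / X ≤ φ.maxRat) :
    |v - X * (roundNE φ (v / X)).toRat|
      ≤ max (φ.unitRoundoff / (1 + φ.unitRoundoff) * |v|) (X * (φ.quantum / 2)) := by
  have habs : |v / X| = |v| / X := by rw [abs_div, abs_of_pos hX]
  have hhi : |v / X| ≤ φ.maxRat := by rwa [habs]
  have hfac : v - X * (roundNE φ (v / X)).toRat = X * (v / X - (roundNE φ (v / X)).toRat) := by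
    rw [mul_sub, mul_div_cancel₀ _ (ne_of_gt hX)]
  rw [hfac, abs_mul, abs_of_pos hX]
  rcases le_or_gt (2 ^ φ.manBits * φ.quantum) (|v / X|) with hn | hs
  · -- normal after scaling
    have h1 := abs_sub_roundNE_le_sharp (φ := φ) hn hhi
    refine le_trans ?_ (le_max_left _ _)
    calc X * |v / X - (roundNE φ (v / X)).toRat|
        ≤ X * (φ.unitRoundoff / (1 + φ.unitRoundoff) * |v / X|) := mul_le_mul_of_nonneg_left h1 hX.le
      _ = φ.unitRoundoff / (1 + φ.unitRoundoff) * |v| := by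
          rw [habs, mul_left_comm, mul_div_cancel₀ _ (ne_of_gt hX)]
  · -- subnormal (or first-binade) after scaling: uniform grid of step quantum
    have hlt : |v / X| < 2 ^ (φ.manBits + 1) * φ.quantum := by
      refine lt_of_lt_of_le hs (mul_le_mul_of_nonneg_right ?_ φ.quantum_pos.le)
      exact pow_le_pow_right₀ (by norm_num) (by omega)
    have h1 := abs_sub_roundNE_le_half_quantum (φ := φ) hlt hhi
    exact le_trans (mul_le_mul_of_nonneg_left h1 hX.le) (le_max_right _ _)

/-- MX CEIL RULE, EVERY ELEMENT of a nonzero block: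
`|Vᵢ - X·fl(Vᵢ/X)| ≤ max (u/(1+u)·|Vᵢ|) (quantum/maxRat · blockMax V)` with `X = ceilScale φ V`.
[cite: RouhaniEtAl2023MX, §3] -/
theorem mxCeilAtom_all (φ : Format) (k : ℕ) (V : Fin k → ℚ) (i : Fin k) (hM : 0 < φ.maxRat)
    (hB : 0 < blockMax V) :
    |V i - ceilScale φ V * (roundNE φ (V i / ceilScale φ V)).toRat|
      ≤ max (φ.unitRoundoff / (1 + φ.unitRoundoff) * |V i|) (φ.quantum / φ.maxRat * blockMax V) := by
  have hX := ceilScale_pos φ V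
  have hq := φ.quantum_pos
  have hhi : |V i| / ceilScale φ V ≤ φ.maxRat := by
    rw [div_le_iff₀ hX, mul_comm]
    exact le_trans (abs_le_blockMax V i) (blockMax_le_ceilScale_mul hM V)
  refine le_trans (scaled_elem_error_le φ hX hhi) (max_le_max le_rfl ?_)
  -- X · q/2 ≤ q/maxRat · blockMax since X · maxRat < 2 · blockMax
  have h2 := ceilScale_mul_maxRat_lt_two_mul hM hB
  rw [div_mul_eq_mul_div, le_div_iff₀ hM]
  nlinarith

/-- OCP FLOOR RULE, EVERY UNCLIPPED ELEMENT of a nonzero block: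
`|Vᵢ - X·fl(Vᵢ/X)| ≤ max (u/(1+u)·|Vᵢ|) (quantum/2^(emaxElem+1) · blockMax V)` with
`X = scaleRat φ V` (`2^emaxElem · X ≤ blockMax V`). [cite: RouhaniEtAl2023MX, §3] -/
theorem mxFloorAtom_unclipped (φ : Format) (k : ℕ) (V : Fin k → ℚ) (i : Fin k)
    (hB : 0 < blockMax V) (h : |V i| / scaleRat φ V ≤ φ.maxRat) :
    |V i - scaleRat φ V * (roundNE φ (V i / scaleRat φ V)).toRat|
      ≤ max (φ.unitRoundoff / (1 + φ.unitRoundoff) * |V i|)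
          (φ.quantum / 2 ^ (φ.emaxElem + 1) * blockMax V) := by
  have hX := scaleRat_pos φ V
  have hq := φ.quantum_pos
  have hP : (0 : ℚ) < 2 ^ φ.emaxElem := zpow_pos (by norm_num) _
  refine le_trans (scaled_elem_error_le φ hX h) (max_le_max le_rfl ?_)
  -- X · q/2 ≤ q/2^(e+1) · blockMax since 2^e · X ≤ blockMax
  have htop := (scaled_blockMax_mem_top_binade φ V hB).1
  rw [le_div_iff₀ hX] at htop
  rw [zpow_add_one₀ (by norm_num : (2 : ℚ) ≠ 0), div_mul_eq_mul_div, le_div_iff₀ (by positivity)]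
  nlinarith

/-- The DEEP (subnormal-after-scaling) relamax constant of the CEIL rule, `quantum / maxRat`:
`1/229376` (E4M3: `2^-9/448`), `1/3758096384` (E5M2: `2^-16/57344`), `1/12` (E2M1: `(1/2)/6`).
[cite: MicikeviciusEtAl2022, Table 1] -/
theorem ceilDeepUnit_values :
    E4M3.quantum / E4M3.maxRat = 1 / 229376 ∧
    E5M2.quantum / E5M2.maxRat = 1 / 3758096384 ∧
    E2M1.quantum / E2M1.maxRat = 1 / 12 := by
  refine ⟨by decide +kernel, by decide +kernel, by decide +kernel⟩

/-- The DEEP relamax constant of the FLOOR rule, `quantum / 2^(emaxElem+1)`: `1/262144` (E4M3: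
`2^-9/2^9`), `1/4294967296` (E5M2: `2^-16/2^16`), `1/16` (E2M1: `(1/2)/8`).
[cite: MicikeviciusEtAl2022, Table 1] -/
theorem floorDeepUnit_values :
    E4M3.quantum / 2 ^ (E4M3.emaxElem + 1) = 1 / 262144 ∧
    E5M2.quantum / 2 ^ (E5M2.emaxElem + 1) = 1 / 4294967296 ∧
    E2M1.quantum / 2 ^ (E2M1.emaxElem + 1) = 1 / 16 := by
  refine ⟨by decide +kernel, by decide +kernel, by decide +kernel⟩

end Summit.Ventures.CertifiedArithmetic.LowPrec.EnvelopeAtoms
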